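import Mathlib
import HarnessLib
import Summits.NavierStokesRegularity.NavierStokesRegularity.Theorems.CompletionRelayChainRelayFrontStepIgnitionSigns
import Summits.NavierStokesRegularity.NavierStokesRegularity.Theorems.CompletionRelayChainRelayFrontStepWakeRates

/-!
# `CompletionRelayChain` — crux `RelayFrontStep` (24850), LINE `window_v2`, stub `stub_ignition` (Phase II):
  the relay ROWS of the front block as two-sided derivative bounds (blueprint §0)

Pure row extraction from `PseudoFlowOn.motion` and `RelayRows` (clocks `Λ₀ = 1`, `Λ₁ = 2^{5/2}` kept symbolic as
`(1+1)^{5·1/2}`, `Λ₂ = 32`, `Λ₋₁ = 2^{−5/2}`; weights `4^k`): for the old shells `0, 1, 2` the equations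
`x₀′, u₀′, r₀′, x₁′, u₁′, r₁′, x₂′, u₂′` with their `κ₁4^k√F` defects, in the form `row − δ ≤ S′ ≤ row + δ`.
Used by the Phase-II window lemma to produce the hypotheses of `runCheck_sound`.

No definitions. HONEST FRAMING: MODEL lattice only (Tao 2016 §4 vocabulary); helper for one registered stub of an open
crux, no stub credit; nothing here is a statement about the Navier–Stokes equations.
-/

noncomputable section

-- the summit-side namespace repeats a component by design (D-0017)
set_option linter.dupNamespace false

open Set MeasureTheory intervalIntegral Literature.Analysis.FluidPDE Literature.Analysis.FluidPDE.TaoCascade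
open Summit.NavierStokesRegularity.NavierStokesRegularity.Theorems
open Summit.NavierStokesRegularity.NavierStokesRegularity.Theorems.RelayFrontStep

namespace Summit.NavierStokesRegularity.NavierStokesRegularity.Cruxes.RelayFrontStep.Window2

variable {τ κ₁ κ₂ : ℝ} {α : Fin 4 → Fin 4 → Fin 4 → ℤ × ℤ × ℤ → ℝ}
  {S₀ F₀ B₀ : Fin 4 → ℤ → ℝ} {S F : Fin 4 → ℤ → ℝ → ℝ}

/-- `Λ₀ = 1` in the `(k:ℝ) − 1` form at `k = 1`. [this file] -/
theorem clock_pred_one : (1 + 1 : ℝ) ^ ((5 : ℝ) * ((((1 : ℤ)) : ℝ) - 1) / 2) = 1 := by norm_num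

/-- `Λ₁` in the `(k:ℝ) − 1` form at `k = 2` equals the `k = 1` form. [this file] -/
theorem clock_pred_two : (1 + 1 : ℝ) ^ ((5 : ℝ) * ((((2 : ℤ)) : ℝ) - 1) / 2) = (1 + 1 : ℝ) ^ ((5 : ℝ) * (((1 : ℤ)) : ℝ) / 2) := by
  norm_num

/-- `Λ₀ = 1`, weight `4⁰ = 1`. [this file] -/
theorem clock_at_zero : (1 + 1 : ℝ) ^ ((5 : ℝ) * (((0 : ℤ)) : ℝ) / 2) = 1 := by norm_num

/-- weight `(1+1)^{2·0} = 1`. [this file] -/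
theorem weight_at_zero : (1 + 1 : ℝ) ^ ((2 : ℝ) * (((0 : ℤ)) : ℝ)) = 1 := by norm_num

/-- **Row `x₁ + x₂`**: `(x₁ + x₂)′ = u₀² − 32u₂² ± (4κ₁√F₀₁ + 16κ₁√F₀₂)` (the internal transfer `Λ₁u₁²` cancels). [this file] -/
theorem s1_deriv_bounds (h : PseudoFlowOn τ 1 α κ₁ κ₂ S₀ F₀ B₀ S F) (hrows : RelayRows α)
    {s : ℝ} (hs : s ∈ Icc 0 τ) :
    S 1 0 s ^ 2 - 32 * S 1 2 s ^ 2 - (κ₁ * 4 * Real.sqrt (F 0 1 s) + κ₁ * 16 * Real.sqrt (F 0 2 s)) ≤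
        derivWithin (S 0 1) (Icc 0 τ) s + derivWithin (S 0 2) (Icc 0 τ) s ∧
      derivWithin (S 0 1) (Icc 0 τ) s + derivWithin (S 0 2) (Icc 0 τ) s ≤
        S 1 0 s ^ 2 - 32 * S 1 2 s ^ 2 + (κ₁ * 4 * Real.sqrt (F 0 1 s) + κ₁ * 16 * Real.sqrt (F 0 2 s)) := by
  have h1 := h.motion 0 1 s hs
  have h2 := h.motion 0 2 s hs
  rw [hrows.1 S 1 s, weight_at_one, clock_pred_one, show (1 - 1 : ℤ) = 0 by norm_num] at h1
  rw [hrows.1 S 2 s, weight_at_two, clock_at_two, clock_pred_two, show (2 - 1 : ℤ) = 1 by norm_num] at h2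
  obtain ⟨l1, u1⟩ := abs_le.mp h1
  obtain ⟨l2, u2⟩ := abs_le.mp h2
  have e0 : S 1 0 s * S 1 0 s = S 1 0 s ^ 2 := by ring
  have e2 : S 1 2 s * S 1 2 s = S 1 2 s ^ 2 := by ring
  constructor <;> nlinarith [l1, u1, l2, u2]

/-- **Row `u₁`**: `u₁′ = Λ₁(x₁u₁ − u₁x₂) − (Λ₁/32)x₂r₁ + (1/32)r₀u₀ ± 4κ₁√F₁₁`. [this file] -/
theorem u1_deriv_bounds (h : PseudoFlowOn τ 1 α κ₁ κ₂ S₀ F₀ B₀ S F) (hrows : RelayRows α)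
    {s : ℝ} (hs : s ∈ Icc 0 τ) :
    (1 + 1 : ℝ) ^ ((5 : ℝ) * (((1 : ℤ)) : ℝ) / 2) * ((S 0 1 s - S 0 2 s) * S 1 1 s)
        - (1 / 32) * ((1 + 1 : ℝ) ^ ((5 : ℝ) * (((1 : ℤ)) : ℝ) / 2) * (S 0 2 s * S 2 1 s))
        + (1 / 32) * (S 2 0 s * S 1 0 s) - κ₁ * 4 * Real.sqrt (F 1 1 s) ≤ derivWithin (S 1 1) (Icc 0 τ) s ∧
      derivWithin (S 1 1) (Icc 0 τ) s ≤
        (1 + 1 : ℝ) ^ ((5 : ℝ) * (((1 : ℤ)) : ℝ) / 2) * ((S 0 1 s - S 0 2 s) * S 1 1 s)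
        - (1 / 32) * ((1 + 1 : ℝ) ^ ((5 : ℝ) * (((1 : ℤ)) : ℝ) / 2) * (S 0 2 s * S 2 1 s))
        + (1 / 32) * (S 2 0 s * S 1 0 s) + κ₁ * 4 * Real.sqrt (F 1 1 s) := by
  have hm := h.motion 1 1 s hs
  rw [hrows.2.1 S 1 s, weight_at_one, clock_pred_one, show (1 - 1 : ℤ) = 0 by norm_num,
    show (1 + 1 : ℤ) = 2 by norm_num] at hm
  obtain ⟨l1, u1⟩ := abs_le.mp hm
  have e : (1 + 1 : ℝ) ^ ((5 : ℝ) * (((1 : ℤ)) : ℝ) / 2) * (S 0 1 s * S 1 1 s - S 1 1 s * S 0 2 s) =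
      (1 + 1 : ℝ) ^ ((5 : ℝ) * (((1 : ℤ)) : ℝ) / 2) * ((S 0 1 s - S 0 2 s) * S 1 1 s) := by ring
  constructor <;> linarith

/-- **Row `r₁`**: `r₁′ = (Λ₁/32)(x₂u₁ − u₁u₂) ± 4κ₁√F₂₁` (upper side; the lower side is `r1_deriv_lower`). [this file] -/
theorem r1_deriv_upper (h : PseudoFlowOn τ 1 α κ₁ κ₂ S₀ F₀ B₀ S F) (hrows : RelayRows α)
    {s : ℝ} (hs : s ∈ Icc 0 τ) :
    derivWithin (S 2 1) (Icc 0 τ) s ≤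
      (1 / 32) * ((1 + 1 : ℝ) ^ ((5 : ℝ) * ((1 : ℤ) : ℝ) / 2) * (S 0 2 s * S 1 1 s - S 1 1 s * S 1 2 s))
        + κ₁ * 4 * Real.sqrt (F 2 1 s) := by
  have hm := h.motion 2 1 s hs
  rw [hrows.2.2.1 S 1 s, weight_at_one, show (1 : ℤ) + 1 = 2 by norm_num] at hm
  linarith [(abs_le.mp hm).2]

/-- **Row `u₂`**: `u₂′ = 32(x₂u₂ − u₂x₃) − x₃r₂ + (Λ₁/32)r₁u₁ ± 16κ₁√F₁₂`. [this file] -/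
theorem u2_deriv_bounds (h : PseudoFlowOn τ 1 α κ₁ κ₂ S₀ F₀ B₀ S F) (hrows : RelayRows α)
    {s : ℝ} (hs : s ∈ Icc 0 τ) :
    32 * ((S 0 2 s - S 0 3 s) * S 1 2 s) - S 0 3 s * S 2 2 s
        + (1 / 32) * ((1 + 1 : ℝ) ^ ((5 : ℝ) * (((1 : ℤ)) : ℝ) / 2) * (S 2 1 s * S 1 1 s))
        - κ₁ * 16 * Real.sqrt (F 1 2 s) ≤ derivWithin (S 1 2) (Icc 0 τ) s ∧
      derivWithin (S 1 2) (Icc 0 τ) s ≤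
        32 * ((S 0 2 s - S 0 3 s) * S 1 2 s) - S 0 3 s * S 2 2 s
        + (1 / 32) * ((1 + 1 : ℝ) ^ ((5 : ℝ) * (((1 : ℤ)) : ℝ) / 2) * (S 2 1 s * S 1 1 s))
        + κ₁ * 16 * Real.sqrt (F 1 2 s) := by
  have hm := h.motion 1 2 s hs
  rw [hrows.2.1 S 2 s, weight_at_two, clock_at_two, clock_pred_two, show (2 + 1 : ℤ) = 3 by norm_num,
    show (2 - 1 : ℤ) = 1 by norm_num] at hm
  obtain ⟨l1, u1⟩ := abs_le.mp hm
  have e : (32 : ℝ) * (S 0 2 s * S 1 2 s - S 1 2 s * S 0 3 s) - 1 / 32 * (32 * (S 0 3 s * S 2 2 s)) =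
      32 * ((S 0 2 s - S 0 3 s) * S 1 2 s) - S 0 3 s * S 2 2 s := by ring
  constructor <;> linarith

/-- **Row `u₀`**: `u₀′ = (x₀u₀ − u₀x₁) − (1/32)x₁r₀ + (1/32)Λ₋₁r₋₁u₋₁ ± κ₁√F₁₀`, with `Λ₋₁ ≤ 0.177`:
one-sided bounds needing only `|r₋₁u₋₁| ≤ P`. [this file] -/
theorem u0_deriv_bounds (h : PseudoFlowOn τ 1 α κ₁ κ₂ S₀ F₀ B₀ S F) (hrows : RelayRows α)
    {s P : ℝ} (hs : s ∈ Icc 0 τ) (hP : |S 2 (-1) s * S 1 (-1) s| ≤ P) :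
    (S 0 0 s - S 0 1 s) * S 1 0 s - (1 / 32) * (S 0 1 s * S 2 0 s) - (1 / 32) * (177 / 1000) * P
        - κ₁ * Real.sqrt (F 1 0 s) ≤ derivWithin (S 1 0) (Icc 0 τ) s ∧
      derivWithin (S 1 0) (Icc 0 τ) s ≤ (S 0 0 s - S 0 1 s) * S 1 0 s - (1 / 32) * (S 0 1 s * S 2 0 s)
        + (1 / 32) * (177 / 1000) * P + κ₁ * Real.sqrt (F 1 0 s) := by
  have hm := h.motion 1 0 s hs
  rw [hrows.2.1 S 0 s, weight_at_zero, clock_at_zero, show (0 + 1 : ℤ) = 1 by norm_num,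
    show (0 - 1 : ℤ) = -1 by norm_num] at hm
  obtain ⟨l1, u1⟩ := abs_le.mp hm
  have hcm : (1 + 1 : ℝ) ^ ((5 : ℝ) * ((((0 : ℤ)) : ℝ) - 1) / 2) ≤ 177 / 1000 := by
    have e : (1 + 1 : ℝ) ^ ((5 : ℝ) * ((((0 : ℤ)) : ℝ) - 1) / 2) = (2 : ℝ) ^ (-(5 : ℝ) / 2) := by norm_num
    rw [e]; exact two_rpow_neg_five_halves_le
  have hcm0 : 0 ≤ (1 + 1 : ℝ) ^ ((5 : ℝ) * ((((0 : ℤ)) : ℝ) - 1) / 2) := clock_nonneg _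
  have hw : |(1 + 1 : ℝ) ^ ((5 : ℝ) * ((((0 : ℤ)) : ℝ) - 1) / 2) * (S 2 (-1) s * S 1 (-1) s)| ≤ 177 / 1000 * P := by
    rw [abs_mul, abs_of_nonneg hcm0]
    exact mul_le_mul hcm hP (abs_nonneg _) (by norm_num)
  obtain ⟨wl, wu⟩ := abs_le.mp hw
  have e : (1 : ℝ) * (S 0 0 s * S 1 0 s - S 1 0 s * S 0 1 s) = (S 0 0 s - S 0 1 s) * S 1 0 s := by ring
  constructor <;> nlinarith [l1, u1, wl, wu]

/-- **Row `r₀`**: `r₀′ = (1/32)u₀(x₁ − u₁) ± κ₁√F₂₀`. [this file] -/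
theorem r0_deriv_bounds (h : PseudoFlowOn τ 1 α κ₁ κ₂ S₀ F₀ B₀ S F) (hrows : RelayRows α)
    {s : ℝ} (hs : s ∈ Icc 0 τ) :
    (1 / 32) * (S 1 0 s * (S 0 1 s - S 1 1 s)) - κ₁ * Real.sqrt (F 2 0 s) ≤ derivWithin (S 2 0) (Icc 0 τ) s ∧
      derivWithin (S 2 0) (Icc 0 τ) s ≤ (1 / 32) * (S 1 0 s * (S 0 1 s - S 1 1 s)) + κ₁ * Real.sqrt (F 2 0 s) := by
  have hm := h.motion 2 0 s hs
  rw [hrows.2.2.1 S 0 s, clock_at_zero, weight_at_zero, show (0 : ℤ) + 1 = 1 by norm_num] at hm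
  obtain ⟨l1, u1⟩ := abs_le.mp hm
  have e : (1 / 32 : ℝ) * (1 * (S 0 1 s * S 1 0 s - S 1 0 s * S 1 1 s)) = (1 / 32) * (S 1 0 s * (S 0 1 s - S 1 1 s)) := by ring
  constructor <;> linarith

/-- **Energy under the slack with a two-phase crude bound**: if `F i k ≤ M₁` on `[0, T]` and `F i k ≤ M₂` on `[T, s]`
(`M₁, M₂, κ₂ ≥ 0`, `0 ≤ T ≤ s ≤ τ`), then `F i k s ≤ ½ S² + B₀ + κ₂(1+1)^{2k}(M₁T + M₂(s − T))`.
[cite: Tao2016AveragedNS, §4 Lemma 4.1 (4.10)] -/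
theorem energy_le_slack₂ (h : PseudoFlowOn τ 1 α κ₁ κ₂ S₀ F₀ B₀ S F) (hκ : 0 ≤ κ₂) (i : Fin 4) (k : ℤ)
    {T s M₁ M₂ : ℝ} (hT : 0 ≤ T) (hTs : T ≤ s) (hs : s ≤ τ)
    (hM₁ : ∀ r ∈ Icc 0 T, F i k r ≤ M₁) (hM₂ : ∀ r ∈ Icc T s, F i k r ≤ M₂) :
    F i k s ≤ (1 / 2) * S i k s ^ 2 + B₀ i k + κ₂ * (1 + 1 : ℝ) ^ ((2 : ℝ) * k) * (M₁ * T + M₂ * (s - T)) := by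
  have hsI : s ∈ Icc 0 τ := ⟨hT.trans hTs, hs⟩
  have h1 := h.defect_upper i k s hsI
  have hc : ContinuousOn (fun u => F i k u) (Icc 0 τ) := (h.contDiffOn_F i k).continuousOn
  have hi1 : IntervalIntegrable (fun u => F i k u) volume 0 T :=
    (hc.mono (by rw [uIcc_of_le hT]; exact Icc_subset_Icc_right (hTs.trans hs))).intervalIntegrable
  have hi2 : IntervalIntegrable (fun u => F i k u) volume T s :=
    (hc.mono (by rw [uIcc_of_le hTs]; exact Icc_subset_Icc hT hs)).intervalIntegrable
  have hsplit := intervalIntegral.integral_add_adjacent_intervals hi1 hi2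
  have hA : (∫ u in (0 : ℝ)..T, F i k u) ≤ M₁ * T := by
    have := intervalIntegral.integral_mono_on hT hi1 (by simp) fun u hu => hM₁ u hu
    rwa [intervalIntegral.integral_const, smul_eq_mul, sub_zero, mul_comm] at this
  have hB : (∫ u in T..s, F i k u) ≤ M₂ * (s - T) := by
    have := intervalIntegral.integral_mono_on hTs hi2 (by simp) fun u hu => hM₂ u hu
    rwa [intervalIntegral.integral_const, smul_eq_mul, mul_comm] at this
  have hw : 0 ≤ κ₂ * (1 + 1 : ℝ) ^ ((2 : ℝ) * k) := mul_nonneg hκ (Real.rpow_pos_of_pos (by norm_num) _).le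
  have h3 := mul_le_mul_of_nonneg_left (show (∫ u in (0 : ℝ)..s, F i k u) ≤ M₁ * T + M₂ * (s - T) by
    rw [← hsplit]; linarith) hw
  simp only [one_add_one_eq_two] at h1 h3 ⊢
  linarith

end Summit.NavierStokesRegularity.NavierStokesRegularity.Cruxes.RelayFrontStep.Window2
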